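import Summits.AtomisticToContinuum.FouriersLaw.Theorems.PhononMeanFreePathIncoherentChannelCommonPastBound
import Summits.AtomisticToContinuum.FouriersLaw.Theorems.PhononMeanFreePathIncoherentChannelLightCone

/-!
# Two horizons: the mean channels of `IncoherentChannel` close under the forecast-loss envelope alone;
# `CoherentDephasing` (stmt-AtomisticToContinuum-11810) from ONE N-uniform envelope

Line `two-horizons-forecast-loss` of crux `PhononMeanFreePath.IncoherentChannel` (stmt-AtomisticToContinuum-11811),
lead prover-line-stmt-AtomisticToContinuum-11811-0. The line's composition `meanChannels_of` (kernel-checked in the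
crux workfile `Cruxes/IncoherentChannel/Lines/two_horizons_forecast_loss.lean`) consumed three stubs; two of them are
now LANDED theorems of this directory — the causality window `stub_lightCone` (p92940) and the fixed-`N` dictionary
`stub_commonPastBound` (p89690). This file records the composition with those two discharged, i.e. CONDITIONAL ONLY on
the remaining N-uniform FORECAST-LOSS ENVELOPE (registered stub `stub_forecastLoss` of the crux, stated here verbatim
as the hypothesis `h₁`; it is NOT a published fact and is not dressed as one):

  `h₁ : ∀ params > 0, ∀ T > 0, ∃ C α, 2 < α ∧ ∀ N t, 0 ≤ t → S_N(t) = fnorm … N t ≤ C (1+t)^{−α}`.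

* `twoHorizons_meanChannels h₁` — at every admissible parameter point: `t ↦ P_N − 2r_N²` and `t ↦ r_N²` are
  integrable on `(0,∞)` for every `N`, `N·∫₀^∞(P_N − 2r_N²) → 0` and `N·∫₀^∞ r_N² → 0`. Proof: with
  `θ = η = (α+2)/(2α)`, split `(0,∞)` at the causal window `N^η`; inside, `stub_lightCone` (`≤ 2ε_N·N^η` with
  `N^{1+η}ε_N → 0`); beyond, `stub_commonPastBound` + `h₁` give the integrable majorant
  `K⁺C^θ(1+t)^{−αθ} + 2TC(1+t)^{−α}` whose tail times `N` is `≲ N^{(2−α)/4} + N^{−(α−2)(α+1)/(2α)} → 0`.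
* `coherentDephasing_of_forecastLoss h₁ : CoherentDephasing` — the route's rank-2 crux (stmt-AtomisticToContinuum-11810)
  BY NAME from the envelope alone (`r_N² ≤ T·S_N`): the coherent Landauer channel is slaved to the forecast norm.
* the chain-free real-analysis toolkit (`twoHorizons_*`: integrability and tails of `(1+t)^{−s}`, the abstract
  window/tail lemma, `N^e → 0` for `e < 0`).

No definition, no `sorry`, axioms standard; the only non-Mathlib inputs are the landed theorems named above and the
route Defs vocabulary (`fnorm`, `pairCorr`, `commonPast`).
-/

noncomputable section

open MeasureTheory Set Filter Topology
open scoped NNReal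

namespace Summit.AtomisticToContinuum.FouriersLaw.Theorems.PhononMeanFreePath

open Literature.MathematicalPhysics.KineticTheory.HeatConduction
open Summit.AtomisticToContinuum.FouriersLaw.Theses.PhononMeanFreePath (CoherentDephasing)

/-! ## Real-analysis toolkit (chain-independent) -/

/-- `(1+t)^{-s}` is integrable on `(0,∞)` for `s > 1`. [folklore] -/
theorem twoHorizons_integrableOn_one_add_rpow_neg {s : ℝ} (hs : 1 < s) :
    IntegrableOn (fun t : ℝ => (1 + t) ^ (-s)) (Ioi (0 : ℝ)) := by
  have h : Integrable (fun t : ℝ => (1 + ‖t‖) ^ (-s)) (volume : Measure ℝ) :=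
    integrable_one_add_norm (E := ℝ) (μ := volume) (by simpa using hs)
  refine (h.integrableOn : IntegrableOn _ (Ioi (0 : ℝ))).congr_fun (fun t ht => ?_) measurableSet_Ioi
  simp only [Real.norm_of_nonneg (le_of_lt (show (0:ℝ) < t from ht))]

/-- Tail of the polynomial envelope: `∫_{(a,∞)} (1+t)^{-s} dt ≤ a^{1-s}/(s-1)` (`s > 1`, `a > 0`). [folklore] -/
theorem twoHorizons_setIntegral_Ioi_one_add_rpow_le {s a : ℝ} (hs : 1 < s) (ha : 0 < a) :
    ∫ t in Ioi a, (1 + t) ^ (-s) ≤ a ^ (1 - s) / (s - 1) := by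
  have h1 : IntegrableOn (fun t : ℝ => (1 + t) ^ (-s)) (Ioi a) :=
    (twoHorizons_integrableOn_one_add_rpow_neg hs).mono_set (Ioi_subset_Ioi ha.le)
  have h2 : IntegrableOn (fun t : ℝ => t ^ (-s)) (Ioi a) :=
    integrableOn_Ioi_rpow_of_lt (by linarith) ha
  calc ∫ t in Ioi a, (1 + t) ^ (-s) ≤ ∫ t in Ioi a, t ^ (-s) := by
        refine setIntegral_mono_on h1 h2 measurableSet_Ioi (fun t ht => ?_)
        have ht : 0 < t := ha.trans ht
        exact Real.rpow_le_rpow_of_nonpos ht (by linarith) (by linarith)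
    _ = a ^ (1 - s) / (s - 1) := by
        rw [integral_Ioi_rpow_of_lt (by linarith) ha, show -s + 1 = 1 - s by ring, neg_div, ← div_neg,
          neg_sub]

/-- TWO HORIZONS, abstractly: if `N`·(window level × window length) `→ 0` and `N`·(tail mass beyond the
window) `→ 0`, then `N · ∫_{(0,∞)} f_N → 0`. [folklore] -/
theorem twoHorizons_tendsto_mul_integral_of_window_tail {f : ℕ → ℝ → ℝ} {a w b : ℕ → ℝ}
    (ha : ∀ N, 0 ≤ a N) (hint : ∀ N, IntegrableOn (f N) (Ioi (0 : ℝ)))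
    (hwin : ∀ (N : ℕ) (t : ℝ), 0 < t → t ≤ a N → |f N t| ≤ w N)
    (htail : ∀ᶠ N : ℕ in atTop, (N : ℝ) * ∫ t in Ioi (a N), |f N t| ≤ b N)
    (hw : Tendsto (fun N : ℕ => (N : ℝ) * (w N * a N)) atTop (𝓝 0))
    (hb : Tendsto b atTop (𝓝 0)) :
    Tendsto (fun N : ℕ => (N : ℝ) * ∫ t in Ioi (0 : ℝ), f N t) atTop (𝓝 0) := by
  refine squeeze_zero_norm' ?_ (by simpa using hw.add hb)
  filter_upwards [htail] with N hN
  have hsplit : ∫ t in Ioi (0 : ℝ), f N t = (∫ t in Ioc 0 (a N), f N t) + ∫ t in Ioi (a N), f N t := by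
    rw [← setIntegral_union Ioc_disjoint_Ioi_same measurableSet_Ioi
      ((hint N).mono_set Ioc_subset_Ioi_self) ((hint N).mono_set (Ioi_subset_Ioi (ha N))),
      Ioc_union_Ioi_eq_Ioi (ha N)]
  have hhead : ‖∫ t in Ioc 0 (a N), f N t‖ ≤ w N * a N := by
    have h := norm_setIntegral_le_of_norm_le_const (μ := (volume : Measure ℝ)) (f := f N)
      (s := Ioc 0 (a N)) (C := w N) measure_Ioc_lt_top
      (fun t ht => by rw [Real.norm_eq_abs]; exact hwin N t ht.1 ht.2)
    rwa [Real.volume_real_Ioc_of_le (ha N), sub_zero] at h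
  have htl : ‖∫ t in Ioi (a N), f N t‖ ≤ ∫ t in Ioi (a N), |f N t| := by
    have := norm_integral_le_integral_norm (μ := volume.restrict (Ioi (a N))) (f N)
    simpa only [Real.norm_eq_abs] using this
  have hN0 : (0 : ℝ) ≤ N := Nat.cast_nonneg N
  rw [norm_mul, Real.norm_natCast, hsplit]
  calc (N : ℝ) * ‖(∫ t in Ioc 0 (a N), f N t) + ∫ t in Ioi (a N), f N t‖
      ≤ (N : ℝ) * (w N * a N + ∫ t in Ioi (a N), |f N t|) := by
        gcongr
        exact (norm_add_le _ _).trans (add_le_add hhead htl)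
    _ = (N : ℝ) * (w N * a N) + (N : ℝ) * ∫ t in Ioi (a N), |f N t| := by ring
    _ ≤ (N : ℝ) * (w N * a N) + b N := by linarith

/-- Powers of `N` with a negative exponent tend to `0` along the naturals. [folklore] -/
theorem twoHorizons_tendsto_natCast_rpow_of_neg {e : ℝ} (he : e < 0) :
    Tendsto (fun N : ℕ => (N : ℝ) ^ e) atTop (𝓝 0) := by
  have h1 := (tendsto_rpow_neg_atTop (show 0 < -e by linarith)).comp tendsto_natCast_atTop_atTop
  refine h1.congr (fun N => ?_)
  simp [Function.comp_apply, neg_neg]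

/-! ## The two horizons close the mean channels -/

/-- **The two horizons close the mean channels, given the forecast-loss envelope.** From the landed causality
window (`stub_lightCone`) and fixed-`N` dictionary (`stub_commonPastBound`) plus the N-uniform envelope `h₁`
(registered stub `stub_forecastLoss` of crux stmt-AtomisticToContinuum-11811, taken as a HYPOTHESIS): at every
parameter point, `t ↦ P_N − 2r_N²` and `t ↦ r_N²` are integrable on `(0,∞)` for every `N`, and
`N·∫₀^∞ (P_N − 2r_N²) → 0`, `N·∫₀^∞ r_N² → 0`. [folklore] -/
theorem twoHorizons_meanChannels
    (h₁ : ∀ ω₂ lam β γ : ℝ, 0 < ω₂ → 0 < lam → 0 < β → 0 < γ → ∀ T : ℝ, 0 < T →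
      ∃ C α : ℝ, 2 < α ∧ ∀ (N : ℕ) (t : ℝ), 0 ≤ t → fnorm ω₂ lam β γ T N t ≤ C * (1 + t) ^ (-α))
    {ω₂ lam β γ : ℝ} (hω : 0 < ω₂) (hl : 0 < lam) (hβ : 0 < β) (hγ : 0 < γ) {T : ℝ} (hT : 0 < T) :
    (∀ N : ℕ, IntegrableOn (fun t => commonPast ω₂ lam β γ T N t - 2 * (pairCorr ω₂ lam β γ T N t) ^ 2)
        (Ioi (0 : ℝ))) ∧
    Tendsto (fun N : ℕ => (N : ℝ) * ∫ t in Ioi (0 : ℝ),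
        (commonPast ω₂ lam β γ T N t - 2 * (pairCorr ω₂ lam β γ T N t) ^ 2)) atTop (𝓝 0) ∧
    (∀ N : ℕ, IntegrableOn (fun t => (pairCorr ω₂ lam β γ T N t) ^ 2) (Ioi (0 : ℝ))) ∧
    Tendsto (fun N : ℕ => (N : ℝ) * ∫ t in Ioi (0 : ℝ), (pairCorr ω₂ lam β γ T N t) ^ 2) atTop (𝓝 0) := by
  -- the data of the three stubs
  obtain ⟨C, α, hα, hS⟩ := h₁ ω₂ lam β γ hω hl hβ hγ T hT
  obtain ⟨hmeas, hr2, hPθ⟩ := stub_commonPastBound ω₂ lam β γ hω hl hβ hγ T hT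
  -- the two exponents (equal): θ for the Hölder bound, η for the causal window
  set θ : ℝ := (α + 2) / (2 * α) with hθdef
  have hα0 : 0 < α := by linarith
  have hθ0 : 0 < θ := by rw [hθdef]; positivity
  have hθ1 : θ < 1 := by
    rw [hθdef, div_lt_one (by positivity)]; linarith
  have hαθ : α * θ = (α + 2) / 2 := by rw [hθdef]; field_simp
  have hαθ1 : 1 < α * θ := by rw [hαθ]; linarith
  -- exponents of the two tail terms, both negative
  have he1 : 1 + θ * (1 - α * θ) = (2 - α) / 4 := by rw [hθdef]; field_simp; ring
  have he2 : 1 + θ * (1 - α) = -((α - 2) * (α + 1)) / (2 * α) := by rw [hθdef]; field_simp; ring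
  have he1neg : 1 + θ * (1 - α * θ) < 0 := by
    rw [he1]; exact div_neg_of_neg_of_pos (by linarith) (by norm_num)
  have he2neg : 1 + θ * (1 - α) < 0 := by
    rw [he2]
    exact div_neg_of_neg_of_pos (neg_neg_of_pos (mul_pos (by linarith) (by linarith))) (by positivity)
  obtain ⟨K, hK⟩ := hPθ θ hθ0 hθ1
  obtain ⟨ε, hε, hwin⟩ := stub_lightCone ω₂ lam β γ hω hl hβ hγ T hT θ hθ0 hθ1
  -- abbreviations
  set S : ℕ → ℝ → ℝ := fun N t => fnorm ω₂ lam β γ T N t with hSdef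
  set P : ℕ → ℝ → ℝ := fun N t => commonPast ω₂ lam β γ T N t with hPdef
  set r : ℕ → ℝ → ℝ := fun N t => pairCorr ω₂ lam β γ T N t with hrdef
  have hS0 : ∀ N t, 0 ≤ S N t := fun N t => fnorm_nonneg ω₂ lam β γ T N t
  -- C ≥ 0 (from `0 ≤ S_N(0) ≤ C`) and the clipped Hölder constant K⁺ = max K 0
  have hC0 : 0 ≤ C := by
    have h := hS 0 0 le_rfl
    simp only [add_zero, Real.one_rpow, mul_one] at h
    exact (hS0 0 0).trans h
  set Kp : ℝ := max K 0 with hKpdef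
  have hKp0 : 0 ≤ Kp := le_max_right _ _
  -- the envelope and the two majorants
  have h1t : ∀ t : ℝ, 0 ≤ t → 0 ≤ (1 + t) ^ (-α) := fun t ht => Real.rpow_nonneg (by linarith) _
  have hSθ : ∀ (N : ℕ) (t : ℝ), 0 ≤ t → S N t ^ θ ≤ C ^ θ * (1 + t) ^ (-(α * θ)) := by
    intro N t ht
    calc S N t ^ θ ≤ (C * (1 + t) ^ (-α)) ^ θ :=
          Real.rpow_le_rpow (hS0 N t) (hS N t ht) hθ0.le
      _ = C ^ θ * (1 + t) ^ (-(α * θ)) := by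
          rw [Real.mul_rpow hC0 (h1t t ht), ← Real.rpow_mul (by linarith : (0:ℝ) ≤ 1 + t), neg_mul]
  have hPbd : ∀ (N : ℕ) (t : ℝ), 0 ≤ t → |P N t| ≤ Kp * C ^ θ * (1 + t) ^ (-(α * θ)) := by
    intro N t ht
    calc |P N t| ≤ K * S N t ^ θ := hK N t ht
      _ ≤ Kp * S N t ^ θ := by
          gcongr
          · exact Real.rpow_nonneg (hS0 N t) θ
          · exact le_max_left _ _
      _ ≤ Kp * (C ^ θ * (1 + t) ^ (-(α * θ))) := by gcongr; exact hSθ N t ht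
      _ = Kp * C ^ θ * (1 + t) ^ (-(α * θ)) := by ring
  have hrbd : ∀ (N : ℕ) (t : ℝ), 0 ≤ t → (r N t) ^ 2 ≤ T * C * (1 + t) ^ (-α) := by
    intro N t ht
    calc (r N t) ^ 2 ≤ T * S N t := hr2 N t ht
      _ ≤ T * (C * (1 + t) ^ (-α)) := by gcongr; exact hS N t ht
      _ = T * C * (1 + t) ^ (-α) := by ring
  set G₁ : ℝ → ℝ := fun t => Kp * C ^ θ * (1 + t) ^ (-(α * θ)) with hG₁def
  set G₂ : ℝ → ℝ := fun t => T * C * (1 + t) ^ (-α) with hG₂def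
  have hG₁int : IntegrableOn G₁ (Ioi (0 : ℝ)) := (twoHorizons_integrableOn_one_add_rpow_neg hαθ1).const_mul _
  have hG₂int : IntegrableOn G₂ (Ioi (0 : ℝ)) :=
    (twoHorizons_integrableOn_one_add_rpow_neg (by linarith : (1:ℝ) < α)).const_mul _
  -- the mean-channel integrand f = P − 2r² and the coherent integrand g = r²
  set f : ℕ → ℝ → ℝ := fun N t => P N t - 2 * (r N t) ^ 2 with hfdef
  set g : ℕ → ℝ → ℝ := fun N t => (r N t) ^ 2 with hgdef
  have hfmeas : ∀ N, Measurable (f N) := fun N =>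
    (hmeas N).1.sub (((hmeas N).2.pow_const 2).const_mul 2)
  have hgmeas : ∀ N, Measurable (g N) := fun N => (hmeas N).2.pow_const 2
  have hfbd : ∀ (N : ℕ) (t : ℝ), 0 ≤ t → |f N t| ≤ G₁ t + 2 * G₂ t := by
    intro N t ht
    have h2 : (0:ℝ) ≤ 2 * (r N t) ^ 2 := by positivity
    calc |f N t| = |P N t - 2 * (r N t) ^ 2| := rfl
      _ ≤ |P N t| + |2 * (r N t) ^ 2| := abs_sub _ _
      _ = |P N t| + 2 * (r N t) ^ 2 := by rw [abs_of_nonneg h2]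
      _ ≤ G₁ t + 2 * G₂ t := by
          have := hPbd N t ht; have := hrbd N t ht
          simp only [hG₁def, hG₂def]; linarith
  have hgbd : ∀ (N : ℕ) (t : ℝ), 0 ≤ t → |g N t| ≤ G₂ t := by
    intro N t ht
    simp only [hgdef, abs_of_nonneg (sq_nonneg (r N t))]
    exact hrbd N t ht
  -- fixed-N integrability by domination
  have hfint : ∀ N, IntegrableOn (f N) (Ioi (0 : ℝ)) := by
    intro N
    refine Integrable.mono' (hG₁int.add (hG₂int.const_mul 2)) (hfmeas N).aestronglyMeasurable ?_
    refine (ae_restrict_iff' measurableSet_Ioi).2 (ae_of_all _ fun t (ht : 0 < t) => ?_)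
    rw [Real.norm_eq_abs]
    have := hfbd N t ht.le
    simpa [Pi.add_apply, mul_comm] using this
  have hgint : ∀ N, IntegrableOn (g N) (Ioi (0 : ℝ)) := by
    intro N
    refine Integrable.mono' hG₂int (hgmeas N).aestronglyMeasurable ?_
    refine (ae_restrict_iff' measurableSet_Ioi).2 (ae_of_all _ fun t (ht : 0 < t) => ?_)
    rw [Real.norm_eq_abs]
    exact hgbd N t ht.le
  -- the causal window a_N = N^θ
  set a : ℕ → ℝ := fun N => (N : ℝ) ^ θ with hadef
  have ha0 : ∀ N, 0 ≤ a N := fun N => Real.rpow_nonneg (Nat.cast_nonneg N) θ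
  have hapos : ∀ N : ℕ, 1 ≤ N → 0 < a N := fun N hN =>
    Real.rpow_pos_of_pos (by exact_mod_cast Nat.lt_of_lt_of_le Nat.zero_lt_one hN) θ
  -- tails of the two majorants beyond a > 0
  have htailG₁ : ∀ {x : ℝ}, 0 < x → IntegrableOn G₁ (Ioi x) ∧
      ∫ t in Ioi x, G₁ t ≤ Kp * C ^ θ * (x ^ (1 - α * θ) / (α * θ - 1)) := by
    intro x hx
    refine ⟨hG₁int.mono_set (Ioi_subset_Ioi hx.le), ?_⟩
    simp only [hG₁def]
    rw [integral_const_mul]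
    exact mul_le_mul_of_nonneg_left (twoHorizons_setIntegral_Ioi_one_add_rpow_le hαθ1 hx) (by positivity)
  have htailG₂ : ∀ {x : ℝ}, 0 < x → IntegrableOn G₂ (Ioi x) ∧
      ∫ t in Ioi x, G₂ t ≤ T * C * (x ^ (1 - α) / (α - 1)) := by
    intro x hx
    refine ⟨hG₂int.mono_set (Ioi_subset_Ioi hx.le), ?_⟩
    simp only [hG₂def]
    rw [integral_const_mul]
    exact mul_le_mul_of_nonneg_left (twoHorizons_setIntegral_Ioi_one_add_rpow_le (by linarith) hx) (by positivity)
  -- exponent bookkeeping: N · (N^θ)^(1-s) = N^(1 + θ(1-s))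
  have hpow : ∀ (N : ℕ), 1 ≤ N → ∀ s : ℝ, (N : ℝ) * (a N) ^ (1 - s) = (N : ℝ) ^ (1 + θ * (1 - s)) := by
    intro N hN s
    have hNpos : (0 : ℝ) < N := by exact_mod_cast Nat.lt_of_lt_of_le Nat.zero_lt_one hN
    simp only [hadef]
    rw [← Real.rpow_mul hNpos.le, Real.rpow_add hNpos, Real.rpow_one]
  -- the two tail sequences
  set b₂ : ℕ → ℝ := fun N => T * C / (α - 1) * (N : ℝ) ^ (1 + θ * (1 - α)) with hb₂def
  set b₁ : ℕ → ℝ := fun N => Kp * C ^ θ / (α * θ - 1) * (N : ℝ) ^ (1 + θ * (1 - α * θ)) + 2 * b₂ N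
    with hb₁def
  have hb₂lim : Tendsto b₂ atTop (𝓝 0) := by
    have := (twoHorizons_tendsto_natCast_rpow_of_neg he2neg).const_mul (T * C / (α - 1))
    simpa [hb₂def] using this
  have hb₁lim : Tendsto b₁ atTop (𝓝 0) := by
    have h1 := (twoHorizons_tendsto_natCast_rpow_of_neg he1neg).const_mul (Kp * C ^ θ / (α * θ - 1))
    have := h1.add (hb₂lim.const_mul 2)
    simpa [hb₁def] using this
  -- tail estimates for N ≥ 1
  have htailg : ∀ᶠ N : ℕ in atTop, (N : ℝ) * ∫ t in Ioi (a N), |g N t| ≤ b₂ N := by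
    filter_upwards [eventually_ge_atTop 1] with N hN
    have hx := hapos N hN
    obtain ⟨hG₂x, hG₂le⟩ := htailG₂ hx
    have hle : ∫ t in Ioi (a N), |g N t| ≤ ∫ t in Ioi (a N), G₂ t :=
      setIntegral_mono_on ((hgint N).mono_set (Ioi_subset_Ioi (ha0 N))).abs hG₂x measurableSet_Ioi
        (fun t ht => hgbd N t ((ha0 N).trans (le_of_lt ht)))
    have hN0 : (0 : ℝ) ≤ N := Nat.cast_nonneg N
    calc (N : ℝ) * ∫ t in Ioi (a N), |g N t| ≤ (N : ℝ) * (T * C * ((a N) ^ (1 - α) / (α - 1))) := by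
          exact mul_le_mul_of_nonneg_left (hle.trans hG₂le) hN0
      _ = T * C / (α - 1) * ((N : ℝ) * (a N) ^ (1 - α)) := by ring
      _ = b₂ N := by rw [hpow N hN α]
  have htailf : ∀ᶠ N : ℕ in atTop, (N : ℝ) * ∫ t in Ioi (a N), |f N t| ≤ b₁ N := by
    filter_upwards [eventually_ge_atTop 1] with N hN
    have hx := hapos N hN
    obtain ⟨hG₁x, hG₁le⟩ := htailG₁ hx
    obtain ⟨hG₂x, hG₂le⟩ := htailG₂ hx
    have hle : ∫ t in Ioi (a N), |f N t| ≤ ∫ t in Ioi (a N), (G₁ t + 2 * G₂ t) :=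
      setIntegral_mono_on ((hfint N).mono_set (Ioi_subset_Ioi (ha0 N))).abs (hG₁x.add (hG₂x.const_mul 2))
        measurableSet_Ioi (fun t ht => hfbd N t ((ha0 N).trans (le_of_lt ht)))
    have hsum : ∫ t in Ioi (a N), (G₁ t + 2 * G₂ t) = (∫ t in Ioi (a N), G₁ t) + 2 * ∫ t in Ioi (a N), G₂ t := by
      rw [integral_add hG₁x (hG₂x.const_mul 2), integral_const_mul (2:ℝ) G₂]
    have hN0 : (0 : ℝ) ≤ N := Nat.cast_nonneg N
    calc (N : ℝ) * ∫ t in Ioi (a N), |f N t|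
        ≤ (N : ℝ) * (Kp * C ^ θ * ((a N) ^ (1 - α * θ) / (α * θ - 1)) +
            2 * (T * C * ((a N) ^ (1 - α) / (α - 1)))) := by
          refine mul_le_mul_of_nonneg_left ?_ hN0
          rw [hsum] at hle
          linarith
      _ = Kp * C ^ θ / (α * θ - 1) * ((N : ℝ) * (a N) ^ (1 - α * θ)) +
            2 * (T * C / (α - 1) * ((N : ℝ) * (a N) ^ (1 - α))) := by ring
      _ = b₁ N := by rw [hpow N hN (α * θ), hpow N hN α]
  -- window bounds (stub 2): |f| ≤ 2ε_N and |g| ≤ ε_N on (0, N^θ]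
  have hwinf : ∀ (N : ℕ) (t : ℝ), 0 < t → t ≤ a N → |f N t| ≤ 2 * ε N := by
    intro N t ht hta
    have hw := hwin N t ht.le hta
    have h2 : (0:ℝ) ≤ 2 * (r N t) ^ 2 := by positivity
    calc |f N t| ≤ |P N t| + |2 * (r N t) ^ 2| := abs_sub _ _
      _ = |P N t| + 2 * (r N t) ^ 2 := by rw [abs_of_nonneg h2]
      _ ≤ 2 * (|P N t| + (r N t) ^ 2) := by linarith [abs_nonneg (P N t)]
      _ ≤ 2 * ε N := by linarith
  have hwing : ∀ (N : ℕ) (t : ℝ), 0 < t → t ≤ a N → |g N t| ≤ ε N := by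
    intro N t ht hta
    have hw := hwin N t ht.le hta
    simp only [hgdef, abs_of_nonneg (sq_nonneg (r N t))]
    linarith [abs_nonneg (P N t)]
  -- window masses: N · (level × length) → 0
  have hNa : ∀ N : ℕ, (N : ℝ) * a N = (N : ℝ) ^ (1 + θ) := by
    intro N
    simp only [hadef]
    rw [Real.rpow_add' (Nat.cast_nonneg N) (by linarith : (1:ℝ) + θ ≠ 0), Real.rpow_one]
  have hwf : Tendsto (fun N : ℕ => (N : ℝ) * (2 * ε N * a N)) atTop (𝓝 0) := by
    have := hε.const_mul 2
    rw [mul_zero] at this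
    refine this.congr (fun N => ?_)
    rw [← hNa N]; ring
  have hwg : Tendsto (fun N : ℕ => (N : ℝ) * (ε N * a N)) atTop (𝓝 0) := by
    refine hε.congr (fun N => ?_)
    rw [← hNa N]; ring
  -- assemble with the abstract two-horizons lemma
  refine ⟨hfint, ?_, hgint, ?_⟩
  · exact twoHorizons_tendsto_mul_integral_of_window_tail ha0 hfint hwinf htailf hwf hb₁lim
  · exact twoHorizons_tendsto_mul_integral_of_window_tail ha0 hgint hwing htailg hwg hb₂lim

/-- **`CoherentDephasing` (route `PhononMeanFreePath`, item stmt-AtomisticToContinuum-11810) from the forecast-loss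
envelope ALONE**: `2r_N² ≤ 2T·S_N` slaves the coherent Landauer channel to the forecast norm; causality and the fixed-`N`
dictionary are landed theorems. CONDITIONAL on `h₁` (= registered stub `stub_forecastLoss`, an N-uniform dephasing
statement, false at the harmonic corner where `CoherentDephasing` fails too). [folklore] -/
theorem coherentDephasing_of_forecastLoss : (∀ ω₂ lam β γ : ℝ, 0 < ω₂ → 0 < lam → 0 < β → 0 < γ → ∀ T : ℝ, 0 < T → ∃ C α : ℝ, 2 < α ∧ ∀ (N : ℕ) (t : ℝ), 0 ≤ t → fnorm ω₂ lam β γ T N t ≤ C * (1 + t) ^ (-α)) → Summit.AtomisticToContinuum.FouriersLaw.Theses.PhononMeanFreePath.CoherentDephasing := by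
  intro h₁ ω₂ lam β γ hω hl hβ hγ T hT
  obtain ⟨-, -, hrint, hrlim⟩ := twoHorizons_meanChannels h₁ hω hl hβ hγ hT
  refine ⟨fun N => ?_, ?_⟩
  · simpa only [pairCorr, fcast] using hrint N
  · simpa only [pairCorr, fcast] using hrlim

end Summit.AtomisticToContinuum.FouriersLaw.Theorems.PhononMeanFreePath

end
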